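import Summits.BirchSwinnertonDyer.BirchSwinnertonDyer.Theses.ByReductionTypeAtTwo
import Summits.BirchSwinnertonDyer.BirchSwinnertonDyer.Theorems.ByReductionTypeAtTwoSupersingularSharpTwo
import Summits.BirchSwinnertonDyer.Rank1Residual.P2.EmptyCellsAtTwo
import HarnessLib

/-!
# Route `ByReductionTypeAtTwo` (rung K4), crux `SupersingularRankZeroAtTwo` (item
# stmt-BirchSwinnertonDyer-19097): the CLASS-LEVEL BRIDGES from the tree's typed signed inputs at
# `p = 2` — the `a₂ = 0` block on REAL objects, the `a₂ = ±2` MATH-BOUND residue (seat `bsd-2adic-ss-1`)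

HONEST FRAMING (cell `bsd-2adic`, run/shared/lean/pub/bsd-2adic/, HUMAN RULINGS D-0036/D-0059/D-0074
«find: the strongest class-level form of 19097 SupersingularRankZeroAtTwo provable from typed
±/signed inputs at 2 (or its typed obstruction)»): THEOREMS ONLY, stated against the REGISTERED crux
constant `Summit.BirchSwinnertonDyer.BirchSwinnertonDyer.Theses.ByReductionTypeAtTwo.SupersingularRankZeroAtTwo`;
every research input an explicit hypothesis; no definition; no named fact; nothing booked; BSD is NOT
proved by any of this (a closed item would close rung K4's leaf, never the summit). PARTITION (D-0054):
X5@2 good-SUPERSINGULAR (RESIDUAL-MAP B1·O1; 763 book230 classes = 757 r0 + 6 r1; class = every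
non-CM `E/ℚ` with `a₂ ∈ {0, ±2}`) × p = 2 — types-the-object-of; closes none.

## The class and its two shapes

`GoodSS W 2` = good reduction at `2` with `2 ∣ a₂(E)`; by the point count of the minimal model
(`Supersingular.frobeniusTrace_two_eq_zero_or`) `a₂(E) ∈ {0, 2, −2}`, and `E(ℚ)[2] = 0`, i.e. `E[2]`
is irreducible (`P2.irr_two_of_goodSS_two`, unconditional). The two shapes have DIFFERENT typed
signed inputs at `2`:

* `a₂ = 0` (Kobayashi's `±` theory is at least STATED on tree objects at `2`): the algebraic object
  `X⁺(E/ℚ_∞)` = `Kobayashi2003.SignedSelmerDualData W κ γ 1` (Def. 1.1, any `p`), the analytic object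
  Pollack's/Sprung's `L♭ = L⁻` at `2` (EXISTS: `exists_isSprungPair_two`; a Pollack pair at `2`:
  `exists_isPollackPair_two`, sibling file), and the typed conjecture `KobayashiMainConjecture W 2 1`
  (`Supersingular/KobayashiMainConjecture.lean`, `@[conjecture]`, stated at EVERY prime). At `2`
  the `+`/`♭` pairing is the verbatim-consistent one: `c♭(a₂ = 0) = 1` is ODD
  (`SharpPackageAnomalyTwo`; `kobayashiConst 2 (−1)`'s twin `c♯ = −4` is even).
* `a₂ = ±2` (Sprung's `♯/♭` theory): the analytic pair at `2` exists (same tree theorem), but NO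
  algebraic `♭`-object at `2` exists in the tree or in print (Sprung, JNT 132 (2012) §7, p. 1499:
  "From now on, assume `p` is odd"; Kitajima–Otsuki 2018: "`p` odd"); the tree's `♭`-door at `2`
  (`BlindLever.bsdp_two_of_oneDivisibility_of_blindControl_flat_of_abbesUllmo`) binds a DATUM `ξ` and
  per-curve root-number / `2`-descent certificates, so it is not ∀-closable over the class, and its
  datum-level package ∀-closed is BSD₂-equivalent (degenerate as a class input). The only printed
  class-level theorem at supersingular `2`, Kurihara–Otsuki, PAMQ 2 (2006) Thm. 0.1 (`a₂ = ±2`,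
  `ord₂(L(E,1)/Ω_E) = ord₂ Tam(E) = 0 ⇒ Sel_{2^∞}(E/ℚ) = 0`), covers only curves with `Ш[2] = 0`.

## Contents

* §1 `supersingularRankZeroAtTwo_of_halves` — the BC3 birth composition (GZK + Miller's two halves
  ∀-closed ⇒ crux) against the route decl.
* §2 `bsdp_two_of_kobayashiMainConjecture_two_of_frobeniusTrace_eq_zero` — THE `a₂ = 0` DOOR ON REAL
  OBJECTS: modularity + GZK (PUB) + {Kobayashi Thm. 1.2 at `2`, Kim Cor. 3.15 at `2`,
  `KobayashiMainConjecture W 2 1`} (typed, `p = 2` twins of the tree's odd-`p` fact bodies) ⇒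
  `BSD(E,2)`; everything else (irreducibility, the pair at `2`, its constant terms `c♭ = 1`,
  `c♯ = −4 ≠ 0`, the cyclotomic variable) is discharged in the kernel.
* §3 `supersingularRankZeroAtTwo_of_kobayashiMainConjecture_two_of_missingPPartAt` — THE CLASS-LEVEL
  FORM: the §2 binders ∀-closed over `a₂ = 0` + the typed output `MissingPPartAt W 2` ∀-closed over
  `a₂ = ±2` (MATH-BOUND) ⇒ `SupersingularRankZeroAtTwo`.

References: [Kobayashi2003] Def. 1.1, Thm. 1.2, (3.6), Conjecture p. 2; [BDKim2013] Cor. 3.15;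
[Sprung2012] §7; [Sprung2017] §1.1, Thm. 1.12, Cor. 4.11; [KitajimaOtsuki2018] §1; Kurihara–Otsuki,
Pure Appl. Math. Q. 2 (2006) 557–568, Thm. 0.1 / Rem. 0.2 (3); [Miller2011LMS] Def. 1.1.
-/

set_option autoImplicit false
-- the Theorems namespace of this sub repeats the summit name by design (D-0017 nested layout)
set_option linter.dupNamespace false

noncomputable section

open scoped Classical MatrixGroups ModularForm

open CongruenceSubgroup WeierstrassCurve Literature.NumberTheory.EllipticCurves
  Literature.NumberTheory.EllipticCurves.ModularForms Literature.NumberTheory.EllipticCurves.Sprung2017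
  Literature.NumberTheory.EllipticCurves.Rank1Residual Literature.NumberTheory.EllipticCurves.Rank1Residual.Typed
  Literature.NumberTheory.EllipticCurves.Kobayashi2003 ZpExtension
  Summit.BirchSwinnertonDyer.Rank1Residual Summit.BirchSwinnertonDyer.Rank1Residual.Supersingular

namespace Summit.BirchSwinnertonDyer.BirchSwinnertonDyer.Theorems

/-! ## §1. The BC3 birth composition against the route decl -/

section Halves

/-- **Bridge (two halves ⇒ crux).** Gross–Zagier–Kolyvagin (`hGZK`, the tree's named fact, a
hypothesis) + the UPPER half `ord₂ #Ш ≤ ord₂ #Ш_an` (`Typed.MissingUpperBoundAt W 2`, Euler-system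
direction) + the LOWER half `ord₂ #Ш_an ≤ ord₂ #Ш` (`Typed.MissingLowerBoundAt W 2`, main-conjecture
direction), each ∀-closed over the crux's class (non-CM, analytic rank `0`, good supersingular at
`2`), give the crux (`missingPPartAt_of_lower_of_upper` + `bsdp_of_missingPPartAt`). This is the
planner's BC3 birth composition `SupersingularRankZeroAtTwo_of` (item evidence
`SupersingularRankZeroAtTwo_birth.lean`) stated against the REGISTERED crux constant. Composition
certificate; nothing asserted. [cite: Miller2011LMS, Def. 1.1] -/
theorem supersingularRankZeroAtTwo_of_halves
    (hGZK : rank_eq_analyticRank_of_analyticRank_le_one)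
    (hU : ∀ (W : WeierstrassCurve ℚ) [W.IsElliptic] [W.IsGloballyMinimal],
      ¬ W.HasCM → W.analyticRank = 0 → GoodSS W 2 → MissingUpperBoundAt W 2)
    (hL : ∀ (W : WeierstrassCurve ℚ) [W.IsElliptic] [W.IsGloballyMinimal],
      ¬ W.HasCM → W.analyticRank = 0 → GoodSS W 2 → MissingLowerBoundAt W 2) :
    Summit.BirchSwinnertonDyer.BirchSwinnertonDyer.Theses.ByReductionTypeAtTwo.SupersingularRankZeroAtTwo := by
  unfold Summit.BirchSwinnertonDyer.BirchSwinnertonDyer.Theses.ByReductionTypeAtTwo.SupersingularRankZeroAtTwo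
  intro W _ _ hcm hr hss
  exact bsdp_of_missingPPartAt W 2 hGZK (by omega)
    (missingPPartAt_of_lower_of_upper W 2 (hL W hcm hr hss) (hU W hcm hr hss))

end Halves

/-! ## §2. The `a₂ = 0` block on REAL objects: Kobayashi's main conjecture at `(E, 2, +)` -/

section TraceZero

variable (W : WeierstrassCurve ℚ) [W.IsElliptic] [W.IsGloballyMinimal]

/-- **The `a₂ = 0` door at `p = 2` on the tree's REAL signed objects.** Let `E = W` be globally
minimal with good reduction at `2`, `a₂(E) = 0` and `L(E,1) ≠ 0`. Grant the PUBLISHED named facts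
modularity (`hmod`) and Gross–Zagier–Kolyvagin (`hGZK`), and three research binders at `p = 2` — the
`p = 2`, `ε = +` specialisations of the bodies of the tree's odd-`p` named facts, NOT in print at `2`
(Kobayashi 2003 and B. D. Kim 2013 print "`p` odd"; Sprung 2012 §7 "From now on, assume `p` is
odd"): `h12` = Kobayashi Thm. 1.2 at `2` (`X⁺(E/ℚ_∞)` finitely generated over `Λ = ℤ₂⟦T⟧`), `hKim`
= Kim Cor. 3.15 at `2` (`g(0) ∼ 2^{v₂ ∏c_ℓ}·#Sel_{2^∞}(E/ℚ)` for a generator `g` of `char X⁺`), and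
`hMC` = THE TREE'S TYPED CONJECTURE `KobayashiMainConjecture W 2 1` (`char X⁺ = (ϖ·L♭)` in the Néron
normalisation, over every Pollack pair at `2`). Then `BSD(E,2)` holds. Chain: a Pollack pair at `2`
EXISTS (`exists_isPollackPair_two`: Sprung's pair at `2`, tree theorem `exists_isSprungPair_two`, with
both constant terms non-zero), so `hMC` yields `char X⁺ = (g)`, `ι g = ϖ·ι L♭`; at `2` and `a₂ = 0`
the `♭` constant is `c♭ = −a₂² + 2a₂ + 1 = 1` (`constantCoeff_flat_two_of_isSprungPair_of_isNewformOf`),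
so `g(0) = ϖ·[0]⁺_f = L(E,1)/Ω_E =: t` EXACTLY (the period ratio `ϖ` cancels — no Manin input, no
`2 ∤ c` issue: the `+`/`♭` pairing at `2` is the verbatim-consistent one, cf.
`SharpPackageAnomalyTwo`); Kim at `2` with GZK (`#Sel_{2^∞} = #Ш[2^∞]`, `valuation_constantCoeff_xi`)
gives `v₂ g(0) = v₂ ∏c_ℓ + v₂ #Ш`; `E(ℚ)[2] = 0` at a supersingular `2` (kernel theorem
`P2.irr_two_of_goodSS_two`) removes the torsion term; hence `v₂ #Ш_an = v₂ #Ш`, i.e.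
`MissingPPartAt W 2`, and `bsdp_of_missingPPartAt`. Nothing asserted beyond the binders.
[cite: Kobayashi2003, Thm. 1.2, (3.6) and Conjecture (p. 2)] [cite: BDKim2013, Cor. 3.15 (p. 199)]
[cite: Sprung2017, §1.1, Thm. 1.12 and Cor. 4.11] [cite: Miller2011LMS, Def. 1.1] -/
theorem bsdp_two_of_kobayashiMainConjecture_two_of_frobeniusTrace_eq_zero
    (hmod : nonempty_modularParametrizationData)
    (hGZK : rank_eq_analyticRank_of_analyticRank_le_one)
    (hgood : W.HasGoodReductionAtPrime 2) (ha : W.frobeniusTrace 2 = 0)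
    (hL : W.entireLFunction 1 ≠ 0)
    (h12 : ∀ (κ : ZpExtension ℚ 2) (γ : Field.absoluteGaloisGroup ℚ),
      κ.IsCyclotomic → κ.IsTopGenerator γ →
      ∀ D : SignedSelmerDualData W κ γ 1, Module.Finite (IwasawaAlgebra 2) D.X)
    (hKim : ∀ (κ : ZpExtension ℚ 2) (γ : Field.absoluteGaloisGroup ℚ),
      κ.IsCyclotomic → κ.IsTopGenerator γ →
      ∀ (D : SignedSelmerDualData W κ γ 1) [Module.Finite (IwasawaAlgebra 2) D.X],
        Module.IsTorsion (IwasawaAlgebra 2) D.X →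
      ∀ g : IwasawaAlgebra 2, D.charIdeal = Ideal.span {g} → Finite (W.selmerGroupPInfty 2) →
        ∃ u : ℤ_[2]ˣ, ((PowerSeries.constantCoeff g : ℤ_[2]) : ℚ_[2]) =
          ((u : ℤ_[2]) : ℚ_[2]) * ((2 : ℕ) : ℚ_[2]) ^ (padicValNat 2 W.tamagawaProduct) *
            (Nat.card (W.selmerGroupPInfty 2) : ℚ_[2]))
    (hMC : KobayashiMainConjecture W 2 1) : BSDp W 2 := by
  have hr : W.analyticRank = 0 := analyticRank_eq_zero_of_entireLFunction_one_ne_zero W hL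
  have hss : GoodSS W 2 := ⟨hgood, by rw [ha]; exact dvd_zero _⟩
  have hirr : W.HasIrreducibleModPGaloisRep 2 := P2.irr_two_of_goodSS_two W hss
  -- modularity: the newform `f` of `E` and the period ratio `ϖ`
  haveI : NeZero (W.conductorNorm ℤ) := ⟨(W.conductorNorm_pos_holds).ne'⟩
  obtain ⟨Dm⟩ := hmod W
  set f := Dm.f with hf_def
  have hf : IsNewformOf W f := Dm.isNewformOf
  obtain ⟨ϖ, hϖpos, hϖeq, hΩpos⟩ := Dm.exists_rat_mul_realPeriodRat_eq_plusPeriod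
  -- `t = ϖ · [0]⁺_f = L(E,1)/Ω_E`
  set s : ℚ := ratPlusSymbol f 0 with hs_def
  set t : ℚ := ϖ * s with ht_def
  have hLval : W.entireLFunction 1 = (((s : ℝ) * plusPeriod f : ℝ) : ℂ) := hf.entireLFunction_one_eq
  have ht : W.entireLFunction 1 / (W.realPeriodRat : ℂ) = ((t : ℚ) : ℂ) := by
    rw [hLval, ← hϖeq, div_eq_iff (Complex.ofReal_ne_zero.mpr hΩpos.ne'), ht_def]
    push_cast
    ring
  have hs0 : s ≠ 0 := by
    intro h0
    apply hL
    rw [hLval, h0]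
    simp
  have ht0 : t ≠ 0 := mul_ne_zero hϖpos.ne' hs0
  -- the cyclotomic setting, the Pollack pair at `2`, the dual of `Sel⁺(E/ℚ_∞)`
  obtain ⟨κ, hκ, γ, hγ, hγ'⟩ := exists_isCyclotomic_isTopGenerator_isCyclotomicVariable_holds 2
  obtain ⟨Ls, Lf, hSP, hPP⟩ := exists_isPollackPair_two hf hgood ha hL
  obtain ⟨D⟩ := nonempty_signedSelmerDualData W κ (1 : ℤˣ) hγ
  haveI := h12 κ γ hκ hγ D
  -- the main conjecture at `(E, 2, +)`: `char X⁺ = (g)`, `ι g = ϖ · ι L♭`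
  obtain ⟨hTors, g, hchar, hιg⟩ := hMC κ γ hκ hγ hγ' f hf ϖ hϖeq Ls Lf hPP D
  have hkL : kobayashiL (1 : ℤˣ) Ls Lf = Lf := by unfold kobayashiL; rw [if_pos rfl]
  rw [hkL] at hιg
  -- (K) at `2` for the datum `ξ := g`: `g(0) ≠ 0`, `v₂ g(0) = v₂ ∏c + v₂ #Ш`
  have hK : (⟨g, 0, 0⟩ : SignedDatum W 2).EulerCharacteristic := fun hfin ↦
    hKim κ γ hκ hγ D hTors g hchar hfin
  obtain ⟨-, hvg⟩ := valuation_constantCoeff_xi W 2 hGZK hL ⟨g, 0, 0⟩ hK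
  -- constant terms: `g(0) = ϖ · L♭(0) = ϖ · [0]⁺_f = t` (`c♭ = 1` at `a₂ = 0`)
  have hLf0 := constantCoeff_flat_two_of_isSprungPair_of_isNewformOf hf hgood hSP
  rw [ha] at hLf0
  have hg0 : ((PowerSeries.constantCoeff g : ℤ_[2]) : ℚ_[2]) = ((t : ℚ) : ℚ_[2]) := by
    have hc := congrArg PowerSeries.constantCoeff hιg
    rw [constantCoeff_iwasawaToPowerSeries, map_mul, PowerSeries.constantCoeff_C,
      constantCoeff_iwasawaToPowerSeries, hLf0] at hc
    rw [hc, ht_def]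
    push_cast
    ring
  -- valuations: `v₂ t = v₂ ∏c + v₂ #Ш`
  have hval : padicValRat 2 t =
      (padicValNat 2 W.tamagawaProduct : ℤ) + padicValNat 2 W.shaOrder := by
    rw [hg0, Padic.valuation_ratCast] at hvg
    exact hvg
  exact bsdp_of_missingPPartAt W 2 hGZK (by omega)
    ⟨t * (W.torsionOrder : ℚ) ^ 2 / (W.tamagawaProduct : ℚ),
      shaAn_eq_of_analyticRank_eq_zero W hGZK hr ht, by
        rw [padicValRat_shaAn_witness W 2 hirr ht0, hval]; ring⟩

end TraceZero

/-! ## §3. The class-level bridge: the `a₂ = 0` block + the typed `a₂ = ±2` residue ⇒ the crux -/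

section ClassLevel

/-- **THE CRUX FROM TYPED SIGNED INPUTS AT `2` (strongest class-level form this seat can certify).**
On the class "non-CM, analytic rank `0`, good supersingular at `2`" (`a₂ ∈ {0, ±2}`, kernel
trichotomy `frobeniusTrace_two_eq_zero_or`), `SupersingularRankZeroAtTwo` follows from the PUBLISHED
named facts modularity (`hmod`, `hmod'`) and GZK (`hGZK`) together with EXACTLY these typed inputs:

* on `a₂ = 0` — the three `p = 2` research binders of
  `bsdp_two_of_kobayashiMainConjecture_two_of_frobeniusTrace_eq_zero`, ∀-closed over the sub-class:
  Kobayashi Thm. 1.2 at `2` (`h12`), Kim Cor. 3.15 at `2` (`hKim`), and the tree's typed conjecture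
  `KobayashiMainConjecture W 2 1` (`hMC`) — statements about the REAL objects `X⁺(E/ℚ_∞)`
  (`Kobayashi2003.SignedSelmerDualData W κ γ 1`) and Sprung's/Pollack's `L♭` at `2` (which EXISTS:
  `exists_isPollackPair_two`), every other input discharged in the kernel (`E(ℚ)[2] = 0`, the `♭`
  constant `c♭ = 1`, `L♯ ≠ 0 ≠ L♭`);
* on `a₂ = ±2` — the whole typed output `MissingPPartAt W 2` (`ord₂ #Ш_an = ord₂ #Ш`), ∀-closed
  (`hpm`): MATH-BOUND — no signed (♯/♭) Selmer group, control theorem, Euler-characteristic formula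
  or main conjecture at `p = 2`, `a₂ = ±2` exists in print (Sprung, JNT 132 (2012) §7: "From now on,
  assume `p` is odd"; Kitajima–Otsuki 2018: "`p` odd"); the one printed class-level result,
  Kurihara–Otsuki 2006 Thm. 0.1 (`a₂ = ±2`, `ord₂(L(E,1)/Ω_E) = ord₂ Tam(E) = 0 ⇒ Sel_{2^∞}(E/ℚ) = 0`),
  covers only curves with `Ш[2] = 0`; the tree's datum-level `♭`-door
  (`BlindLever.bsdp_two_of_oneDivisibility_of_blindControl_flat_of_abbesUllmo`) is per-curve
  (root-number and `2`-descent-certificate binders) and is not ∀-closable over the class.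

Composition certificate; nothing asserted beyond the binders; closes nothing by itself.
[cite: Kobayashi2003, Thm. 1.2 and Conjecture (p. 2)] [cite: BDKim2013, Cor. 3.15 (p. 199)]
[cite: Sprung2012, §7 (p. 1499)] [cite: Sprung2017, §1.1 and Cor. 4.11] [cite: Miller2011LMS, Def. 1.1] -/
theorem supersingularRankZeroAtTwo_of_kobayashiMainConjecture_two_of_missingPPartAt
    (hmod : nonempty_modularParametrizationData) (hmod' : hasEntireLFunction_rat)
    (hGZK : rank_eq_analyticRank_of_analyticRank_le_one)
    (h12 : ∀ (W : WeierstrassCurve ℚ) [W.IsElliptic] [W.IsGloballyMinimal],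
      ¬ W.HasCM → W.analyticRank = 0 → GoodSS W 2 → W.frobeniusTrace 2 = 0 →
      ∀ (κ : ZpExtension ℚ 2) (γ : Field.absoluteGaloisGroup ℚ),
        κ.IsCyclotomic → κ.IsTopGenerator γ →
        ∀ D : SignedSelmerDualData W κ γ 1, Module.Finite (IwasawaAlgebra 2) D.X)
    (hKim : ∀ (W : WeierstrassCurve ℚ) [W.IsElliptic] [W.IsGloballyMinimal],
      ¬ W.HasCM → W.analyticRank = 0 → GoodSS W 2 → W.frobeniusTrace 2 = 0 →
      ∀ (κ : ZpExtension ℚ 2) (γ : Field.absoluteGaloisGroup ℚ),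
        κ.IsCyclotomic → κ.IsTopGenerator γ →
        ∀ (D : SignedSelmerDualData W κ γ 1) [Module.Finite (IwasawaAlgebra 2) D.X],
          Module.IsTorsion (IwasawaAlgebra 2) D.X →
        ∀ g : IwasawaAlgebra 2, D.charIdeal = Ideal.span {g} → Finite (W.selmerGroupPInfty 2) →
          ∃ u : ℤ_[2]ˣ, ((PowerSeries.constantCoeff g : ℤ_[2]) : ℚ_[2]) =
            ((u : ℤ_[2]) : ℚ_[2]) * ((2 : ℕ) : ℚ_[2]) ^ (padicValNat 2 W.tamagawaProduct) *
              (Nat.card (W.selmerGroupPInfty 2) : ℚ_[2]))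
    (hMC : ∀ (W : WeierstrassCurve ℚ) [W.IsElliptic] [W.IsGloballyMinimal],
      ¬ W.HasCM → W.analyticRank = 0 → GoodSS W 2 → W.frobeniusTrace 2 = 0 →
        KobayashiMainConjecture W 2 1)
    (hpm : ∀ (W : WeierstrassCurve ℚ) [W.IsElliptic] [W.IsGloballyMinimal],
      ¬ W.HasCM → W.analyticRank = 0 → GoodSS W 2 →
        (W.frobeniusTrace 2 = 2 ∨ W.frobeniusTrace 2 = -2) → MissingPPartAt W 2) :
    Summit.BirchSwinnertonDyer.BirchSwinnertonDyer.Theses.ByReductionTypeAtTwo.SupersingularRankZeroAtTwo := by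
  unfold Summit.BirchSwinnertonDyer.BirchSwinnertonDyer.Theses.ByReductionTypeAtTwo.SupersingularRankZeroAtTwo
  intro W _ _ hcm hr hss
  rcases frobeniusTrace_two_eq_zero_or W hss.1 hss.2 with ha | ha2
  · have hL : W.entireLFunction 1 ≠ 0 := (W.analyticRank_eq_zero_iff_holds (hmod' W)).1 hr
    exact bsdp_two_of_kobayashiMainConjecture_two_of_frobeniusTrace_eq_zero W hmod hGZK hss.1 ha hL
      (h12 W hcm hr hss ha) (hKim W hcm hr hss ha) (hMC W hcm hr hss ha)
  · exact bsdp_of_missingPPartAt W 2 hGZK (by omega) (hpm W hcm hr hss ha2)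

end ClassLevel

end Summit.BirchSwinnertonDyer.BirchSwinnertonDyer.Theorems

end
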